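import Summits.CriticalPhenomena.PercolationContinuityZ3.Theorems.Transplant.KNCells2ChainS
import HarnessLib

/-!
# APPENDING planar schedules (`ChainPlanar.Schedule`, p249958): run `S₁` (steps `0 … N₁`), then `S₂` (steps `N₁+1 … N₁+1+N₂`) when the first core
# of `S₂` IS the last core of `S₁` and the radii agree — the glue for composite target chains (the (C) corridor: localise ∘ localise ∘ band run;
# p1-g9 05:24:56Z "`append` yours")

builds on p205010 (kernel theorem, internal audit signed; external expert review pending) — nothing in this file uses p205010.
Lane `prim-bschramm`, seat `prim-bschramm-p5` (gen 6; (C) column of the D″ order of battle, rulings R2/R3 2026-08-21T05:09:29Z), helper file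
(`--supports stmt-CriticalPhenomena-4575 --as helper`).  Pure `Site 2` bookkeeping, no geometry.
* `ChainPlanar.pw N f g` — the piecewise sequence (`f` up to `N`, then `g` shifted by `N + 1`), `pw_of_le`, `pw_of_not_le`, `pw_add`, `pw_add_succ`;
* **`Schedule.append S₁ S₂ (hR : S₂.R' = S₁.R') (hjoin : S₂.core 0 = S₁.core (S₁.N + 1))`** — `N = N₁ + 1 + N₂`, extents `[min ℓ₀, max ℓ₁]`,
  prism `S₁.prism ∪ S₂.prism`; accessors `append_params`, `append_ax/Wb/region/lo/hi/core/level_left` (`k ≤ N₁`), `…_right` (step `N₁ + 1 + j`),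
  `append_core_left'` (`k ≤ N₁ + 1`), `append_core_joint`, `append_core_zero`, `append_core_last`, `append_region_subset`.
[cite: KozmaNitzan2024, §4 Lemma 12 (pp. 23–25: the rounds are run one after the other)]
-/

noncomputable section

namespace Summit.CriticalPhenomena.PercolationContinuityZ3.Theorems

namespace Transplant

namespace ChainPlanar

open Literature.Probability.Percolation Literature.Probability.LatticeModels
open Literature.Probability.Percolation.KozmaNitzan
open Literature.Probability.Percolation.KozmaNitzan.Cells (oth oth_ne eq_oth_of_ne)

/-! ## §1 Piecewise sequences -/

/-- The piecewise sequence: `f k` for `k ≤ N`, then `g (k − (N+1))`. [folklore] -/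
def pw {β : Type*} (N : ℕ) (f g : ℕ → β) (k : ℕ) : β := if k ≤ N then f k else g (k - (N + 1))

/-- Below the cut the piecewise sequence is the first one. [folklore] -/
@[simp] theorem pw_of_le {β : Type*} {N k : ℕ} (f g : ℕ → β) (h : k ≤ N) : pw N f g k = f k := if_pos h

/-- Above the cut the piecewise sequence is the shifted second one. [folklore] -/
theorem pw_of_not_le {β : Type*} {N k : ℕ} (f g : ℕ → β) (h : ¬ k ≤ N) : pw N f g k = g (k - (N + 1)) := if_neg h

/-- At `N + 1 + j` the piecewise sequence is `g j`. [folklore] -/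
@[simp] theorem pw_add {β : Type*} (N j : ℕ) (f g : ℕ → β) : pw N f g (N + 1 + j) = g j := by
  rw [pw, if_neg (by omega), show N + 1 + j - (N + 1) = j by omega]

/-- At `N + 1 + j + 1` the piecewise sequence is `g (j + 1)`. [folklore] -/
@[simp] theorem pw_add_succ {β : Type*} (N j : ℕ) (f g : ℕ → β) : pw N f g (N + 1 + j + 1) = g (j + 1) := by
  rw [show N + 1 + j + 1 = N + 1 + (j + 1) by omega, pw_add]

/-! ## §2 Appending two schedules -/

namespace Schedule

/-- **Appending two planar schedules**: run `S₁` (steps `0, …, N₁`), then `S₂` (its step `j` becomes step `N₁ + 1 + j`), provided the radii agree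
and the first core of `S₂` is the last core of `S₁`; extents in `[min ℓ₀, max ℓ₁]`, prism the union. [cite: KozmaNitzan2024, §4 Lemma 12 (pp. 23–25)] -/
def append (S₁ S₂ : Schedule) (hR : S₂.R' = S₁.R') (hjoin : S₂.core 0 = S₁.core (S₁.N + 1)) : Schedule where
  ax := pw S₁.N S₁.ax S₂.ax
  lo := pw S₁.N S₁.lo S₂.lo
  hi := pw S₁.N S₁.hi S₂.hi
  region := pw S₁.N S₁.region S₂.region
  prism := S₁.prism ∪ S₂.prism
  N := S₁.N + 1 + S₂.N
  R' := S₁.R'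
  ℓ₀ := min S₁.ℓ₀ S₂.ℓ₀
  ℓ₁ := max S₁.ℓ₁ S₂.ℓ₁
  Wb := pw S₁.N S₁.Wb S₂.Wb
  encl k hk := by
    by_cases h : k ≤ S₁.N
    · simp only [pw_of_le _ _ h]
      exact S₁.encl k h
    · obtain ⟨j, rfl⟩ : ∃ j, k = S₁.N + 1 + j := ⟨k - (S₁.N + 1), by omega⟩
      simp only [pw_add, ← hR]
      exact S₂.encl j (by omega)
  succ k hk := by
    by_cases h : k + 1 ≤ S₁.N
    · simp only [pw_of_le _ _ h, pw_of_le _ _ (Nat.le_of_succ_le h)]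
      exact S₁.succ k (Nat.le_of_succ_le h)
    · by_cases h' : k = S₁.N
      · subst h'
        rw [pw_of_le _ _ le_rfl, pw_of_not_le _ _ (by omega), pw_of_not_le _ _ (by omega), Nat.sub_self]
        have e : Finset.Icc (S₂.lo 0) (S₂.hi 0) = S₂.core 0 := rfl
        rw [e, hjoin]
        exact S₁.succ S₁.N le_rfl
      · obtain ⟨j, rfl⟩ : ∃ j, k = S₁.N + 1 + j := ⟨k - (S₁.N + 1), by omega⟩
        simp only [pw_add, pw_add_succ]
        exact S₂.succ j (by omega)
  sub_prism k hk := by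
    by_cases h : k ≤ S₁.N
    · simp only [pw_of_le _ _ h]
      exact (S₁.sub_prism k h).trans Finset.subset_union_left
    · obtain ⟨j, rfl⟩ : ∃ j, k = S₁.N + 1 + j := ⟨k - (S₁.N + 1), by omega⟩
      simp only [pw_add]
      exact (S₂.sub_prism j (by omega)).trans Finset.subset_union_right
  nonempty k hk := by
    by_cases h : k ≤ S₁.N
    · simp only [pw_of_le _ _ h]
      exact S₁.nonempty k (by omega)
    · obtain ⟨j, rfl⟩ : ∃ j, k = S₁.N + 1 + j := ⟨k - (S₁.N + 1), by omega⟩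
      simp only [pw_add]
      exact S₂.nonempty j (by omega)
  route k hk v hv := by
    by_cases h : k ≤ S₁.N
    · simp only [pw_of_le _ _ h] at hv ⊢
      obtain ⟨ℓ, h0, h1, σ, hσ, hrect, τ, hτ, hhalf⟩ := S₁.route k h v hv
      refine ⟨ℓ, (min_le_left _ _).trans h0, h1.trans (le_max_left _ _), σ, hσ, hrect, τ, hτ, fun y e1 e2 e3 => ?_⟩
      have hy := hhalf y e1 e2 e3
      by_cases h' : k + 1 ≤ S₁.N
      · simp only [pw_of_le _ _ h']
        exact hy
      · have ek : k = S₁.N := by omega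
        subst ek
        rw [pw_of_not_le _ _ (by omega), pw_of_not_le _ _ (by omega), Nat.sub_self]
        have e : Finset.Icc (S₂.lo 0) (S₂.hi 0) = S₂.core 0 := rfl
        rw [e, hjoin]
        exact hy
    · obtain ⟨j, rfl⟩ : ∃ j, k = S₁.N + 1 + j := ⟨k - (S₁.N + 1), by omega⟩
      simp only [pw_add, pw_add_succ, ← hR] at hv ⊢
      obtain ⟨ℓ, h0, h1, σ, hσ, hrect, τ, hτ, hhalf⟩ := S₂.route j (by omega) v hv
      exact ⟨ℓ, (min_le_right _ _).trans h0, h1.trans (le_max_right _ _), σ, hσ, hrect, τ, hτ, hhalf⟩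

variable (S₁ S₂ : Schedule) (hR : S₂.R' = S₁.R') (hjoin : S₂.core 0 = S₁.core (S₁.N + 1))

/-- The parameters of the appended schedule. [folklore] -/
theorem append_params : (S₁.append S₂ hR hjoin).N = S₁.N + 1 + S₂.N ∧ (S₁.append S₂ hR hjoin).R' = S₁.R' ∧
    (S₁.append S₂ hR hjoin).ℓ₀ = min S₁.ℓ₀ S₂.ℓ₀ ∧ (S₁.append S₂ hR hjoin).ℓ₁ = max S₁.ℓ₁ S₂.ℓ₁ ∧
    (S₁.append S₂ hR hjoin).prism = S₁.prism ∪ S₂.prism :=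
  ⟨rfl, rfl, rfl, rfl, rfl⟩

/-- The first steps have the axes of `S₁`. [folklore] -/
@[simp] theorem append_ax_left {k : ℕ} (hk : k ≤ S₁.N) : (S₁.append S₂ hR hjoin).ax k = S₁.ax k := pw_of_le _ _ hk

/-- The later steps have the axes of `S₂`. [folklore] -/
@[simp] theorem append_ax_right (j : ℕ) : (S₁.append S₂ hR hjoin).ax (S₁.N + 1 + j) = S₂.ax j := pw_add _ _ _ _

/-- The first steps have the spreads of `S₁`. [folklore] -/
@[simp] theorem append_Wb_left {k : ℕ} (hk : k ≤ S₁.N) : (S₁.append S₂ hR hjoin).Wb k = S₁.Wb k := pw_of_le _ _ hk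

/-- The later steps have the spreads of `S₂`. [folklore] -/
@[simp] theorem append_Wb_right (j : ℕ) : (S₁.append S₂ hR hjoin).Wb (S₁.N + 1 + j) = S₂.Wb j := pw_add _ _ _ _

/-- The first steps have the regions of `S₁`. [folklore] -/
@[simp] theorem append_region_left {k : ℕ} (hk : k ≤ S₁.N) : (S₁.append S₂ hR hjoin).region k = S₁.region k := pw_of_le _ _ hk

/-- The later steps have the regions of `S₂`. [folklore] -/
@[simp] theorem append_region_right (j : ℕ) : (S₁.append S₂ hR hjoin).region (S₁.N + 1 + j) = S₂.region j := pw_add _ _ _ _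

/-- The first lower corners are those of `S₁`. [folklore] -/
@[simp] theorem append_lo_left {k : ℕ} (hk : k ≤ S₁.N) : (S₁.append S₂ hR hjoin).lo k = S₁.lo k := pw_of_le _ _ hk

/-- The later lower corners are those of `S₂`. [folklore] -/
@[simp] theorem append_lo_right (j : ℕ) : (S₁.append S₂ hR hjoin).lo (S₁.N + 1 + j) = S₂.lo j := pw_add _ _ _ _

/-- The first upper corners are those of `S₁`. [folklore] -/
@[simp] theorem append_hi_left {k : ℕ} (hk : k ≤ S₁.N) : (S₁.append S₂ hR hjoin).hi k = S₁.hi k := pw_of_le _ _ hk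

/-- The later upper corners are those of `S₂`. [folklore] -/
@[simp] theorem append_hi_right (j : ℕ) : (S₁.append S₂ hR hjoin).hi (S₁.N + 1 + j) = S₂.hi j := pw_add _ _ _ _

/-- The first levels are the levels of `S₁`. [folklore] -/
@[simp] theorem append_level_left {k : ℕ} (hk : k ≤ S₁.N) (i : ℕ) : (S₁.append S₂ hR hjoin).level k i = S₁.level k i := by
  rw [level, level, append_lo_left S₁ S₂ hR hjoin hk, append_hi_left S₁ S₂ hR hjoin hk]

/-- The later levels are the levels of `S₂`. [folklore] -/
@[simp] theorem append_level_right (j i : ℕ) : (S₁.append S₂ hR hjoin).level (S₁.N + 1 + j) i = S₂.level j i := by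
  rw [level, level, append_lo_right, append_hi_right]

/-- The first cores are the cores of `S₁` (steps `k ≤ N₁`). [folklore] -/
@[simp] theorem append_core_left {k : ℕ} (hk : k ≤ S₁.N) : (S₁.append S₂ hR hjoin).core k = S₁.core k := by
  rw [core, core, append_lo_left S₁ S₂ hR hjoin hk, append_hi_left S₁ S₂ hR hjoin hk]

/-- The later cores are the cores of `S₂`. [folklore] -/
@[simp] theorem append_core_right (j : ℕ) : (S₁.append S₂ hR hjoin).core (S₁.N + 1 + j) = S₂.core j := by
  rw [core, core, append_lo_right, append_hi_right]

/-- The cores up to the joint (`k ≤ N₁ + 1`) are the cores of `S₁`. [folklore] -/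
theorem append_core_left' {k : ℕ} (hk : k ≤ S₁.N + 1) : (S₁.append S₂ hR hjoin).core k = S₁.core k := by
  rcases Nat.lt_or_eq_of_le hk with h | rfl
  · exact append_core_left S₁ S₂ hR hjoin (Nat.lt_succ_iff.1 h)
  · rw [show S₁.N + 1 = S₁.N + 1 + 0 by omega, append_core_right, hjoin]

/-- The joint core is the first core of `S₂`. [folklore] -/
theorem append_core_joint : (S₁.append S₂ hR hjoin).core (S₁.N + 1) = S₂.core 0 := by
  rw [show S₁.N + 1 = S₁.N + 1 + 0 by omega, append_core_right]

/-- The first core of the appended schedule is the first core of `S₁`. [folklore] -/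
theorem append_core_zero : (S₁.append S₂ hR hjoin).core 0 = S₁.core 0 := append_core_left S₁ S₂ hR hjoin (Nat.zero_le _)

/-- **The last core of the appended schedule is the last core of `S₂`.** [folklore] -/
theorem append_core_last : (S₁.append S₂ hR hjoin).core ((S₁.append S₂ hR hjoin).N + 1) = S₂.core (S₂.N + 1) := by
  rw [(append_params S₁ S₂ hR hjoin).1, show S₁.N + 1 + S₂.N + 1 = S₁.N + 1 + (S₂.N + 1) by omega, append_core_right]

/-- The prism of the appended schedule holds both prisms' regions: every region lies in `S₁.prism ∪ S₂.prism`. [folklore] -/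
theorem append_region_subset {k : ℕ} (hk : k ≤ (S₁.append S₂ hR hjoin).N) : (S₁.append S₂ hR hjoin).region k ⊆ S₁.prism ∪ S₂.prism :=
  (S₁.append S₂ hR hjoin).sub_prism k hk

end Schedule

end ChainPlanar

end Transplant

end Summit.CriticalPhenomena.PercolationContinuityZ3.Theorems

end
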